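import Literature.AlgebraicGeometry.Frobenioids.PreFrobenioidMorphisms
import Literature.AlgebraicGeometry.Frobenioids.PreFrobenioidData
import HarnessLib

/-!
# Frobenioids I: the operations `(Base, Div, deg_Fr)` of a pre-Frobenioid functor `C ⥤ F_Φ` — the
# adapter from the cell's Def. 1.1–1.2 files to the §3–§4 statement interface

Mochizuki, *The geometry of Frobenioids I* (2008), Def. 1.1 (iv) p. 20, Rem. 1.1.1 p. 21, Def. 1.2
pp. 21–23 [cite: MochizukiFrdI2008, Def. 1.1 (iv) p.20]. This file discharges the MERGE DEBT recorded
when `PreFrobenioidData.lean` (INTERFACE for the §3/§4/§6 statement files) was landed ahead of the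
definition files `ElementaryFrobenioid.lean` / `PreFrobenioidMorphisms.lean` (seat abc-iut-found):

* `PreFrobenioidData.ofFunctor Φ F`: a functor `F : C ⥤ ElemFrobenioid Φ` yields the operations
  `(baseFunctor F, Φ, pull Φ, Div F, degFr F)` with the laws of Remark 1.1.1 (found's `pull_id`,
  `pull_comp`, `div_id`, `div_comp`, `degFr_id`, `degFr_comp`);
* for each notion of Def. 1.2 used by the §3–§4 statements, `PreFrobenioidData.IsX (ofFunctor Φ F) ↔
  PreFrobenioid.IsX F` (by `Iff.rfl` or a one-line rewrite), so that a named fact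
  `∀ F, IsFrobenioid F → Thm34… (ofFunctor Φ₁ F₁) (ofFunctor Φ₂ F₂) Ψ` speaks about found's notions.
No statement of the paper is strengthened.
-/

namespace Literature.AlgebraicGeometry.Frobenioids

open CategoryTheory Opposite

universe w v v' u u'

variable {D : Type u} [Category.{v} D] (Φ : Dᵒᵖ ⥤ CommMonCat.{w}) {C : Type u'} [Category.{v'} C]
  (F : C ⥤ ElemFrobenioid Φ)

namespace PreFrobenioidData

/-- The operations of the pre-Frobenioid structure `F : C ⥤ F_Φ` (FrdI Def. 1.1 (iv): "the operations
`Base(-)`, `Div(-)`, `deg_Fr(-)` on `F_Φ` restrict to operations on `C`"; laws = Remark 1.1.1).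
[cite: MochizukiFrdI2008, Def. 1.1 (iv) p.20] -/
noncomputable def ofFunctor : PreFrobenioidData.{w} C D where
  base := PreFrobenioid.baseFunctor F
  Mon X := Φ.obj (op X)
  pull f := Frobenioids.pull Φ f
  pull_id X x := Frobenioids.pull_id Φ X x
  pull_comp β α x := Frobenioids.pull_comp Φ β α x
  div φ := PreFrobenioid.Div F φ
  degFr φ := PreFrobenioid.degFr F φ
  div_id A := PreFrobenioid.div_id F A
  div_comp ψ φ := PreFrobenioid.div_comp F ψ φ
  degFr_id A := PreFrobenioid.degFr_id F A
  degFr_comp ψ φ := PreFrobenioid.degFr_comp F ψ φ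

variable {Φ}

/-- `Base` of the adapter is found's `baseFunctor`. [cite: MochizukiFrdI2008, Def. 1.1 (iv) p.20] -/
@[simp] theorem ofFunctor_base : (ofFunctor Φ F).base = PreFrobenioid.baseFunctor F := rfl

/-- `deg_Fr` of the adapter is found's `degFr`. [cite: MochizukiFrdI2008, Def. 1.1 (iv) p.20] -/
@[simp] theorem ofFunctor_degFr {A B : C} (φ : A ⟶ B) : (ofFunctor Φ F).degFr φ = PreFrobenioid.degFr F φ := rfl

/-- `Div` of the adapter is found's `Div`. [cite: MochizukiFrdI2008, Def. 1.1 (iv) p.20] -/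
@[simp] theorem ofFunctor_div {A B : C} (φ : A ⟶ B) : (ofFunctor Φ F).div φ = PreFrobenioid.Div F φ := rfl

/-! ### Definition 1.2 through the adapter -/

/-- Linear. [cite: MochizukiFrdI2008, Def. 1.2 (i) p.21] -/
theorem ofFunctor_isLinear {A B : C} (φ : A ⟶ B) :
    (ofFunctor Φ F).IsLinear φ ↔ PreFrobenioid.IsLinear F φ := Iff.rfl

/-- Isometry. [cite: MochizukiFrdI2008, Def. 1.2 (i) p.21] -/
theorem ofFunctor_isIsometry {A B : C} (φ : A ⟶ B) :
    (ofFunctor Φ F).IsIsometry φ ↔ PreFrobenioid.IsIsometry F φ := Iff.rfl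

/-- Base-isomorphism. [cite: MochizukiFrdI2008, Def. 1.2 (ii) p.21] -/
theorem ofFunctor_isBaseIso {A B : C} (φ : A ⟶ B) :
    (ofFunctor Φ F).IsBaseIso φ ↔ PreFrobenioid.IsBaseIso F φ := Iff.rfl

/-- Base-identity endomorphism. [cite: MochizukiFrdI2008, Def. 1.2 (ii) p.21] -/
theorem ofFunctor_isBaseIdentity {A : C} (φ : A ⟶ A) :
    (ofFunctor Φ F).IsBaseIdentity φ ↔ PreFrobenioid.IsBaseIdentity F φ := Iff.rfl

/-- Div-identity endomorphism (pointwise vs as `MonoidHom`). [cite: MochizukiFrdI2008, Def. 1.2 (ii) p.22] -/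
theorem ofFunctor_isDivIdentity {A : C} (φ : A ⟶ A) :
    (ofFunctor Φ F).IsDivIdentity φ ↔ PreFrobenioid.IsDivIdentity F φ := by
  change (∀ x, Frobenioids.pull Φ (PreFrobenioid.Base F φ) x = x) ↔
    Frobenioids.pull Φ (PreFrobenioid.Base F φ) = MonoidHom.id _
  exact ⟨fun h => MonoidHom.ext h, fun h x => DFunLike.congr_fun h x⟩

/-- Pre-step. [cite: MochizukiFrdI2008, Def. 1.2 (iii) p.22] -/
theorem ofFunctor_isPreStep {A B : C} (φ : A ⟶ B) :
    (ofFunctor Φ F).IsPreStep φ ↔ PreFrobenioid.IsPreStep F φ := Iff.rfl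

/-- Co-angular (the isometric-pre-step hypothesis is split in found's rendering).
[cite: MochizukiFrdI2008, Def. 1.2 (iii) p.22] -/
theorem ofFunctor_isCoAngular {A B : C} (φ : A ⟶ B) :
    (ofFunctor Φ F).IsCoAngular φ ↔ PreFrobenioid.IsCoAngular F φ :=
  ⟨fun h _ _ γ β α e hα hβ hβ' hbi => h γ β α e hα ⟨hβ', hβ⟩ hbi,
    fun h _ _ γ β α e hα hβ hbi => h γ β α e hα hβ.2 hβ.1 hbi⟩

/-- LB-invertible. [cite: MochizukiFrdI2008, Def. 1.2 (iii) p.22] -/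
theorem ofFunctor_isLBInvertible {A B : C} (φ : A ⟶ B) :
    (ofFunctor Φ F).IsLBInvertible φ ↔ PreFrobenioid.IsLBInvertible F φ := by
  rw [IsLBInvertible, ofFunctor_isCoAngular]; rfl

/-- Frobenius type. [cite: MochizukiFrdI2008, Def. 1.2 (iii) p.22] -/
theorem ofFunctor_isFrobeniusType {A B : C} (φ : A ⟶ B) :
    (ofFunctor Φ F).IsFrobeniusType φ ↔ PreFrobenioid.IsFrobeniusType F φ := by
  rw [IsFrobeniusType, ofFunctor_isLBInvertible]; rfl

/-- `O^▷(A)`. [cite: MochizukiFrdI2008, Def. 1.2 (ii) p.22] -/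
theorem ofFunctor_endSubmonoid (A : C) : (ofFunctor Φ F).endSubmonoid A = PreFrobenioid.endSubmonoid F A := rfl

/-- `O^×(A)`. [cite: MochizukiFrdI2008, Def. 1.2 (ii) p.22] -/
theorem ofFunctor_unitsSubgroup (A : C) : (ofFunctor Φ F).unitsSubgroup A = PreFrobenioid.unitsSubgroup F A := rfl

/-- Isotropic object. [cite: MochizukiFrdI2008, Def. 1.2 (iv) p.23] -/
theorem ofFunctor_isIsotropic (A : C) :
    (ofFunctor Φ F).IsIsotropic A ↔ PreFrobenioid.IsIsotropic F A :=
  ⟨fun h _ ψ h1 h2 => h ψ ⟨h2, h1⟩, fun h _ ψ hψ => h ψ hψ.2 hψ.1⟩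

/-- Group-like object. [cite: MochizukiFrdI2008, Def. 1.2 (iv) p.23] -/
theorem ofFunctor_isGroupLikeObj (A : C) :
    (ofFunctor Φ F).IsGroupLikeObj A ↔ PreFrobenioid.IsGroupLikeObj F A := Iff.rfl

/-- Unit-trivial object (`= ⊥` vs "every element is `1`"). [cite: MochizukiFrdI2008, Def. 1.2 (iv) p.23] -/
theorem ofFunctor_isUnitTrivial (A : C) :
    (ofFunctor Φ F).IsUnitTrivial A ↔ PreFrobenioid.IsUnitTrivial F A :=
  (Subgroup.eq_bot_iff_forall _)

/-- Frobenius-trivial object. [cite: MochizukiFrdI2008, Def. 1.2 (iv) p.22] -/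
theorem ofFunctor_isFrobeniusTrivial (A : C) :
    (ofFunctor Φ F).IsFrobeniusTrivial A ↔ PreFrobenioid.IsFrobeniusTrivial F A := by
  simp only [IsFrobeniusTrivial, PreFrobenioid.IsFrobeniusTrivial, ofFunctor_isFrobeniusType]
  rfl

end PreFrobenioidData

end Literature.AlgebraicGeometry.Frobenioids
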